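import Mathlib
import Summits.Ventures.HodgeRepro.Tier4.Line1.RTFSetting
import Summits.Ventures.HodgeRepro.Tier4.Line1.KernelUnfold

/-!
# Tier4/Line1/InnerBridge — `S.inner` is the `L²(DG)` inner product (the bridge J1's assembly uses)

Blind re-derivation cell `pub-hodge-repro`, Tier 4 «prove the step» (README §9–§10), seat t4-L4-p1 (cross-line J1 glue,
lead S12599).  Tree path `lean/Summits/Ventures/HodgeRepro/Tier4/Line1/InnerBridge.lean`.  Mathlib-level; no literature.

WHAT IS PROVED.  For `φ, ψ ∈ L²(DG, μ)` (`MemLp … 2 (S.μ.restrict S.DG)`), the setting's pairing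
`S.inner φ ψ = ∫_{DG} φ · conj ψ` is Mathlib's inner product of the classes with the slots SWAPPED (Mathlib's inner product
is conjugate-linear in the first slot): `S.inner φ ψ = ⟪toLp ψ, toLp φ⟫` (`inner_eq_inner_toLp`); the class `toL2` of a
continuous function; `inner_self_eq_normSq`; and the conjugate symmetry `S.inner ψ φ = conj (S.inner φ ψ)`.

HC_CM is NOT proved by anyone in this repository.
-/

set_option autoImplicit false

noncomputable section

namespace Summit.Ventures.HodgeRepro.Tier4.Line1

open MeasureTheory Topology
open scoped ComplexConjugate InnerProductSpace

namespace RTF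

variable {G : Type} [Group G] [TopologicalSpace G] [IsTopologicalGroup G] [MeasurableSpace G]
  [BorelSpace G]

namespace Setting

variable (S : Setting G)

omit [IsTopologicalGroup G] [BorelSpace G] in
/-- **The bridge**: `S.inner φ ψ = ⟪toLp ψ, toLp φ⟫` for `φ, ψ ∈ L²(DG)`. -/
theorem inner_eq_inner_toLp {φ ψ : G → ℂ} (hφ : MemLp φ 2 (S.μ.restrict S.DG))
    (hψ : MemLp ψ 2 (S.μ.restrict S.DG)) :
    S.inner φ ψ = ⟪hψ.toLp ψ, hφ.toLp φ⟫_ℂ := by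
  rw [MeasureTheory.L2.inner_def]
  unfold inner
  refine integral_congr_ae ?_
  filter_upwards [hψ.coeFn_toLp, hφ.coeFn_toLp] with x hx1 hx2
  rw [hx1, hx2]
  simp only [RCLike.inner_apply]

omit [IsTopologicalGroup G] [BorelSpace G] in
/-- Conjugate symmetry of `S.inner`. -/
theorem inner_conj {φ ψ : G → ℂ} (hφ : MemLp φ 2 (S.μ.restrict S.DG)) (hψ : MemLp ψ 2 (S.μ.restrict S.DG)) :
    S.inner ψ φ = conj (S.inner φ ψ) := by
  rw [inner_eq_inner_toLp S hψ hφ, inner_eq_inner_toLp S hφ hψ, ← inner_conj_symm]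

omit [IsTopologicalGroup G] [BorelSpace G] in
/-- `S.inner ψ ψ = ‖toLp ψ‖²`. -/
theorem inner_self_eq_normSq {ψ : G → ℂ} (hψ : MemLp ψ 2 (S.μ.restrict S.DG)) :
    S.inner ψ ψ = ((‖hψ.toLp ψ‖ ^ 2 : ℝ) : ℂ) := by
  rw [inner_eq_inner_toLp S hψ hψ, inner_self_eq_norm_sq_to_K]
  push_cast
  rfl

/-- The `L²(DG)` class of a continuous function. -/
def toL2 {ψ : G → ℂ} (hψ : Continuous ψ) : Lp ℂ 2 (S.μ.restrict S.DG) :=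
  (S.memLp_restrict_of_continuous hψ).toLp ψ

omit [IsTopologicalGroup G] in
/-- The class of a continuous function is a.e. the function. -/
theorem coeFn_toL2 {ψ : G → ℂ} (hψ : Continuous ψ) : ⇑(S.toL2 hψ) =ᵐ[S.μ.restrict S.DG] ψ :=
  (S.memLp_restrict_of_continuous hψ).coeFn_toLp

omit [IsTopologicalGroup G] in
/-- The bridge for continuous functions. -/
theorem inner_eq_inner_toL2 {φ ψ : G → ℂ} (hφ : Continuous φ) (hψ : Continuous ψ) :
    S.inner φ ψ = ⟪S.toL2 hψ, S.toL2 hφ⟫_ℂ :=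
  inner_eq_inner_toLp S (S.memLp_restrict_of_continuous hφ) (S.memLp_restrict_of_continuous hψ)

omit [IsTopologicalGroup G] in
/-- `toL2` is additive. -/
theorem toL2_add {φ ψ : G → ℂ} (hφ : Continuous φ) (hψ : Continuous ψ) :
    S.toL2 (hφ.add hψ) = S.toL2 hφ + S.toL2 hψ := by
  unfold toL2
  rw [← MemLp.toLp_add]

omit [IsTopologicalGroup G] in
/-- `toL2` is homogeneous. -/
theorem toL2_smul {ψ : G → ℂ} (hψ : Continuous ψ) (c : ℂ) :
    S.toL2 (continuous_const.mul hψ : Continuous fun x => c * ψ x) = c • S.toL2 hψ := by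
  unfold toL2
  rw [← MemLp.toLp_const_smul]
  rfl

omit [IsTopologicalGroup G] in
/-- The class of a continuous function is zero iff the function vanishes a.e. on `DG`. -/
theorem toL2_eq_zero_iff {ψ : G → ℂ} (hψ : Continuous ψ) :
    S.toL2 hψ = 0 ↔ ψ =ᵐ[S.μ.restrict S.DG] 0 := by
  unfold toL2
  rw [← MemLp.toLp_zero (MemLp.zero : MemLp (0 : G → ℂ) 2 (S.μ.restrict S.DG)),
    MemLp.toLp_eq_toLp_iff]

end Setting

end RTF

end Summit.Ventures.HodgeRepro.Tier4.Line1

end
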